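import Literature.Analysis.Complex.LoewnerFastTrackConcave
import HarnessLib

/-!
# Loewner's theorem, Part I — step 2: Löwner's characterization, necessity
# (Hansen 2013, Lemma 3.1 / Theorem 3.2 `⇒`): `n`-monotone `C¹` functions have positive
# semidefinite Loewner matrices

Second brick of the hard direction (`→`) of `Literature.Analysis.Complex.loewner_theorem` along
Hansen's fast track [Hansen2013]. Main result:

* `loewner_matrix_posSemidef_of_monotone` — if `f ∈ C¹(a, b)` is `n`-monotone (Hermitian `n × n`
  matrices with spectra in `(a, b)`), then for all nodes `d₁, …, dₙ ∈ (a, b)` the Loewner matrix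
  `([dᵢ, dⱼ]_f)` (divided differences, `[d, d]_f = f'(d)`) is positive semidefinite
  (Löwner 1934; Hansen 2013, Theorem 3.2, `⇒`).

Hansen derives this from the first-order perturbation formula (Lemma 3.1)
`d/dt ⟨f(x + th)ξ, ξ⟩|₀ = ⟨(h ∘ L)ξ, ξ⟩`, proved for polynomials and extended "by approximation".
We make the approximation quantitative and purely algebraic, avoiding derivatives of matrix
functions:

* `pow_sub_pow_eq_sum_mul_sub_mul`, `exists_telescoping_form` — exact first-order telescoping
  `p(y) - p(x) = B_p(y, x)(y - x)` for polynomials, with `B_p(diag d, diag d)(h) = h ∘ L_p(d)`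
  (confluent divided differences of monomials, `sum_pow_mul_pow_eq_ite`);
* `conjTranspose_mul_cfc_sub_cfc_mul_apply` — the mixed-basis identity
  `[U⋆(F(y) - F(x))V]ⱼₖ = (F(μₖ) - F(λⱼ))[U⋆V]ⱼₖ` for `x = U D_λ U⋆`, `y = V D_μ V⋆` (Rosenblum–Rovnyak,
  Ch. 2 Addenda no. 3, Lemma A, in coordinates), whence the Lipschitz remainder estimate
  `norm_star_dotProduct_mulVec_le` for `g = f - p` with `|g'| ≤ δ`;
* `exists_polynomial_near_with_derivative` — simultaneous approximation of `f` and `f'` by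
  polynomials on a compact interval (Weierstrass for `f'` and an antiderivative);
* `re_quadForm_loewner_polynomial_ge` — the core estimate `Re ξ⋆L_p(d)ξ ≥ -n⁴ δ (∑|ξᵢ|)²` obtained
  from monotonicity along `x = diag d ↦ x + t𝟙𝟙ᵀ`, `t → 0⁺`;
* spectrum localisation of the perturbed matrices through positive semidefinite comparisons
  (`spectrum_subset_Ici_of_posSemidef_sub`, `posSemidef_of_ones`).

Loewner matrices are written inline as `Matrix.of fun i j => [dᵢ, dⱼ]_f` with Mathlib's `slope`;
no new definitions.
-/

noncomputable section

open scoped ComplexOrder ComplexConjugate MatrixOrder Matrix.Norms.L2Operator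
open Complex Set Filter Topology Metric Real Matrix Polynomial

namespace Literature.Analysis.Complex

/-! ## Loewner's characterization (Hansen 2013, Lemma 3.1 / Theorem 3.2) — algebraic part -/

section LoewnerAlgebra

variable {R : Type*} [Ring R]

/-- Noncommutative telescoping: `yᵐ - xᵐ = ∑_{a<m} yᵃ (y - x) x^{m-1-a}`. [folklore] -/
theorem pow_sub_pow_eq_sum_mul_sub_mul (x y : R) (m : ℕ) :
    y ^ m - x ^ m = ∑ a ∈ Finset.range m, y ^ a * (y - x) * x ^ (m - 1 - a) := by
  induction m with
  | zero => simp
  | succ m ih =>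
    rw [Finset.sum_range_succ, Nat.add_sub_cancel, Nat.sub_self, pow_zero, mul_one]
    have h : ∑ a ∈ Finset.range m, y ^ a * (y - x) * x ^ (m - a) =
        (∑ a ∈ Finset.range m, y ^ a * (y - x) * x ^ (m - 1 - a)) * x := by
      rw [Finset.sum_mul]
      refine Finset.sum_congr rfl fun a ha => ?_
      have ha' : a < m := Finset.mem_range.mp ha
      have : m - a = (m - 1 - a) + 1 := by omega
      rw [this, pow_succ]
      simp only [mul_assoc]
    rw [h, ← ih]
    noncomm_ring

end LoewnerAlgebra

section LoewnerDividedDifference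

/-- The confluent divided difference of a polynomial: the slope off the diagonal, the derivative
on it. (Inline notion; see Hansen 2013, §3.) [cite: Hansen2013, Section 3] -/
theorem sum_pow_mul_pow_eq_slope {u v : ℝ} (huv : u ≠ v) (m : ℕ) :
    ∑ a ∈ Finset.range m, u ^ a * v ^ (m - 1 - a) = slope (fun x : ℝ => x ^ m) v u := by
  have h := geom_sum₂_mul u v m
  rw [slope_def_field]
  field_simp [sub_ne_zero.2 huv]
  linarith [h]

/-- The divided difference of the monomial `xᵐ` at `(u, v)`, confluent value included:
`∑_{a<m} uᵃ v^{m-1-a}`. It equals the slope for `u ≠ v` and `(xᵐ)'(u)` for `u = v`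
(confluent case: Mathlib's `geom_sum₂_self`). [folklore] -/
theorem sum_pow_mul_pow_eq_ite (u v : ℝ) (m : ℕ) :
    ∑ a ∈ Finset.range m, u ^ a * v ^ (m - 1 - a) =
      if u = v then (Polynomial.X ^ m : ℝ[X]).derivative.eval u
      else slope (fun x : ℝ => x ^ m) v u := by
  split_ifs with h
  · subst h
    rw [geom_sum₂_self, Polynomial.derivative_X_pow, Polynomial.eval_mul,
      Polynomial.eval_C, Polynomial.eval_pow, Polynomial.eval_X]
  · exact sum_pow_mul_pow_eq_slope h m

end LoewnerDividedDifference

section MixedBasis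

variable {m : Type*} [Fintype m] [DecidableEq m]

/-- `aeval` of a real diagonal matrix. [folklore] -/
theorem aeval_diagonal_ofReal (d : m → ℝ) (p : ℝ[X]) :
    aeval (diagonal fun i => (d i : ℂ)) p = diagonal fun i => ((p.eval (d i) : ℝ) : ℂ) := by
  induction p using Polynomial.induction_on' with
  | add p q hp hq =>
    rw [map_add, hp, hq, diagonal_add]
    simp only [Polynomial.eval_add, ofReal_add]
  | monomial j c =>
    rw [aeval_monomial, diagonal_pow, Algebra.algebraMap_eq_smul_one, smul_mul_assoc, one_mul]
    have : (c : ℂ) • diagonal ((fun i => (d i : ℂ)) ^ j) = (c : ℝ) • diagonal ((fun i => (d i : ℂ)) ^ j) :=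
      rfl
    rw [← diagonal_smul]
    congr 1
    funext i
    simp only [Pi.smul_apply, Pi.pow_apply, Polynomial.eval_monomial, ofReal_mul, ofReal_pow]
    rw [Complex.real_smul, mul_comm]

/-- The functional calculus of a real diagonal matrix. [folklore] -/
theorem cfc_diagonal_ofReal (d : m → ℝ) (F : ℝ → ℝ) :
    cfc F (diagonal fun i => (d i : ℂ)) = diagonal fun i => ((F (d i) : ℝ) : ℂ) := by
  have hD : (diagonal fun i => (d i : ℂ)).IsHermitian := by
    rw [Matrix.IsHermitian, diagonal_conjTranspose]
    congr 1
    funext i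
    simp
  obtain ⟨p, hp⟩ := exists_polynomial_eqOn_finite
    ((Set.finite_range d).union (Matrix.finite_real_spectrum (A := diagonal fun i => (d i : ℂ))))
    F
  rw [cfc_eq_aeval_of_eqOn hD fun x hx => hp x (Or.inr hx), aeval_diagonal_ofReal]
  congr 1
  funext i
  rw [hp _ (Or.inl ⟨i, rfl⟩)]

/-- **Mixed-basis identity for matrix functions** (the Daleckiĭ–Kreĭn / Loewner divided-difference
identity, Rosenblum–Rovnyak Ch. 2 Addenda no. 3 Lemma A in coordinates): if `x = U D_λ U⋆` and
`y = V D_μ V⋆` with `U, V` unitary, then for every real function `F`,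
`[U⋆ (F(y) - F(x)) V]ⱼₖ = (F(μₖ) - F(λⱼ)) [U⋆ V]ⱼₖ` and `[U⋆ (y - x) V]ⱼₖ = (μₖ - λⱼ) [U⋆ V]ⱼₖ`.
[cite: RosenblumRovnyak1985, Ch. 2 Examples and Addenda no. 3 Lemma A] -/
theorem conjTranspose_mul_cfc_sub_cfc_mul_apply {U V : Matrix m m ℂ}
    (hU : U ∈ Matrix.unitaryGroup m ℂ) (hV : V ∈ Matrix.unitaryGroup m ℂ) (lam mu : m → ℝ)
    (F : ℝ → ℝ) (j k : m) :
    (star U * (cfc F (V * diagonal (fun i => (mu i : ℂ)) * star V) -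
        cfc F (U * diagonal (fun i => (lam i : ℂ)) * star U)) * V) j k =
      ((F (mu k) - F (lam j) : ℝ) : ℂ) * (star U * V) j k := by
  have hDl : (diagonal fun i => (lam i : ℂ)).IsHermitian := by
    rw [Matrix.IsHermitian, diagonal_conjTranspose]; congr 1; funext i; simp
  have hDm : (diagonal fun i => (mu i : ℂ)).IsHermitian := by
    rw [Matrix.IsHermitian, diagonal_conjTranspose]; congr 1; funext i; simp
  rw [cfc_unitary_conj hDm hV, cfc_unitary_conj hDl hU, cfc_diagonal_ofReal, cfc_diagonal_ofReal]
  have hU' : star U * U = 1 := Matrix.mem_unitaryGroup_iff'.mp hU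
  have hV' : star V * V = 1 := Matrix.mem_unitaryGroup_iff'.mp hV
  rw [Matrix.mul_sub, Matrix.sub_mul]
  have e1 : star U * (V * diagonal (fun i => ((F (mu i) : ℝ) : ℂ)) * star V) * V =
      star U * V * diagonal (fun i => ((F (mu i) : ℝ) : ℂ)) := by
    simp only [Matrix.mul_assoc, hV', Matrix.mul_one]
  have e2 : star U * (U * diagonal (fun i => ((F (lam i) : ℝ) : ℂ)) * star U) * V =
      diagonal (fun i => ((F (lam i) : ℝ) : ℂ)) * (star U * V) := by
    rw [show star U * (U * diagonal (fun i => ((F (lam i) : ℝ) : ℂ)) * star U) * V =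
      (star U * U) * (diagonal (fun i => ((F (lam i) : ℝ) : ℂ)) * (star U * V)) by
        simp only [Matrix.mul_assoc], hU', Matrix.one_mul]
  rw [e1, e2, Matrix.sub_apply, mul_diagonal, diagonal_mul, ofReal_sub]
  ring

/-- The same identity for the matrices themselves. [folklore] -/
theorem conjTranspose_mul_sub_mul_apply {U V : Matrix m m ℂ}
    (hU : U ∈ Matrix.unitaryGroup m ℂ) (hV : V ∈ Matrix.unitaryGroup m ℂ) (lam mu : m → ℝ)
    (j k : m) :
    (star U * (V * diagonal (fun i => (mu i : ℂ)) * star V -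
        U * diagonal (fun i => (lam i : ℂ)) * star U) * V) j k =
      ((mu k - lam j : ℝ) : ℂ) * (star U * V) j k := by
  have hU' : star U * U = 1 := Matrix.mem_unitaryGroup_iff'.mp hU
  have hV' : star V * V = 1 := Matrix.mem_unitaryGroup_iff'.mp hV
  rw [Matrix.mul_sub, Matrix.sub_mul]
  have e1 : star U * (V * diagonal (fun i => (mu i : ℂ)) * star V) * V =
      star U * V * diagonal (fun i => (mu i : ℂ)) := by
    simp only [Matrix.mul_assoc, hV', Matrix.mul_one]
  have e2 : star U * (U * diagonal (fun i => (lam i : ℂ)) * star U) * V =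
      diagonal (fun i => (lam i : ℂ)) * (star U * V) := by
    rw [show star U * (U * diagonal (fun i => (lam i : ℂ)) * star U) * V =
      (star U * U) * (diagonal (fun i => (lam i : ℂ)) * (star U * V)) by
        simp only [Matrix.mul_assoc], hU', Matrix.one_mul]
  rw [e1, e2, Matrix.sub_apply, mul_diagonal, diagonal_mul, ofReal_sub]
  ring

end MixedBasis

section QuadFormBound

variable {m : Type*} [Fintype m] [DecidableEq m]

/-- The quadratic form of `M` in mixed unitary coordinates:
`ξ⋆ M ξ = ∑ⱼₖ conj((U⋆ξ)ⱼ) [U⋆ M V]ⱼₖ (V⋆ξ)ₖ`. [folklore] -/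
theorem star_dotProduct_mulVec_eq_sum_mixed {U V : Matrix m m ℂ}
    (hU : U ∈ Matrix.unitaryGroup m ℂ) (hV : V ∈ Matrix.unitaryGroup m ℂ) (M : Matrix m m ℂ)
    (ξ : m → ℂ) :
    star ξ ⬝ᵥ (M *ᵥ ξ) = ∑ j, ∑ k, star ((star U *ᵥ ξ) j) * (star U * M * V) j k *
      (star V *ᵥ ξ) k := by
  have hU' : U * star U = 1 := Matrix.mem_unitaryGroup_iff.mp hU
  have hV' : V * star V = 1 := Matrix.mem_unitaryGroup_iff.mp hV
  have hM : M = U * (star U * M * V) * star V := by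
    rw [show U * (star U * M * V) * star V = (U * star U) * M * (V * star V) by
      simp only [Matrix.mul_assoc], hU', hV', Matrix.one_mul, Matrix.mul_one]
  conv_lhs => rw [hM]
  rw [← mulVec_mulVec, ← mulVec_mulVec, dotProduct_mulVec]
  have hsv : star ξ ᵥ* U = star (star U *ᵥ ξ) := by
    rw [star_mulVec, star_eq_conjTranspose, conjTranspose_conjTranspose]
  rw [hsv]
  simp only [dotProduct, mulVec, Pi.star_apply, Finset.mul_sum]
  refine Finset.sum_congr rfl fun j _ => Finset.sum_congr rfl fun k _ => ?_
  ring

/-- Entries of `U⋆ M V` are bounded by the entry sum of `M` (`U`, `V` unitary). [folklore] -/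
theorem norm_conjTranspose_mul_mul_apply_le {U V : Matrix m m ℂ}
    (hU : U ∈ Matrix.unitaryGroup m ℂ) (hV : V ∈ Matrix.unitaryGroup m ℂ) (M : Matrix m m ℂ)
    (j k : m) : ‖(star U * M * V) j k‖ ≤ ∑ i, ∑ l, ‖M i l‖ := by
  rw [Matrix.mul_apply]
  refine (norm_sum_le _ _).trans ?_
  rw [Finset.sum_comm]
  refine Finset.sum_le_sum fun l _ => ?_
  rw [Matrix.mul_apply, Finset.sum_mul]
  refine (norm_sum_le _ _).trans (Finset.sum_le_sum fun i _ => ?_)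
  rw [norm_mul, norm_mul]
  have h1 : ‖(star U) j i‖ ≤ 1 := by
    rw [star_eq_conjTranspose, conjTranspose_apply, norm_star]
    exact entry_norm_bound_of_unitary hU i j
  have h2 : ‖V l k‖ ≤ 1 := entry_norm_bound_of_unitary hV l k
  calc ‖(star U) j i‖ * ‖M i l‖ * ‖V l k‖ ≤ 1 * ‖M i l‖ * 1 := by
        gcongr
    _ = ‖M i l‖ := by ring

/-- Entries of `U⋆ ξ` are bounded by the entry sum of `ξ` (`U` unitary). [folklore] -/
theorem norm_conjTranspose_mulVec_apply_le {U : Matrix m m ℂ} (hU : U ∈ Matrix.unitaryGroup m ℂ)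
    (ξ : m → ℂ) (j : m) : ‖(star U *ᵥ ξ) j‖ ≤ ∑ i, ‖ξ i‖ := by
  rw [mulVec, dotProduct]
  refine (norm_sum_le _ _).trans (Finset.sum_le_sum fun i _ => ?_)
  rw [norm_mul]
  have h1 : ‖(star U) j i‖ ≤ 1 := by
    rw [star_eq_conjTranspose, conjTranspose_apply, norm_star]
    exact entry_norm_bound_of_unitary hU i j
  calc ‖(star U) j i‖ * ‖ξ i‖ ≤ 1 * ‖ξ i‖ := by gcongr
    _ = ‖ξ i‖ := one_mul _

/-- **Error bound for matrix functions in the quadratic form**: if in mixed coordinates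
`|[U⋆ M V]ⱼₖ| ≤ κ S` for all `j, k`, then `|ξ⋆ M ξ| ≤ (card m)² κ S (∑ |ξᵢ|)²`. [folklore] -/
theorem norm_star_dotProduct_mulVec_le {U V : Matrix m m ℂ}
    (hU : U ∈ Matrix.unitaryGroup m ℂ) (hV : V ∈ Matrix.unitaryGroup m ℂ) {M : Matrix m m ℂ}
    {κ S : ℝ} (hκ : 0 ≤ κ) (hS : 0 ≤ S) (hN : ∀ j k, ‖(star U * M * V) j k‖ ≤ κ * S) (ξ : m → ℂ) :
    ‖star ξ ⬝ᵥ (M *ᵥ ξ)‖ ≤ (Fintype.card m : ℝ) ^ 2 * κ * S * (∑ i, ‖ξ i‖) ^ 2 := by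
  rw [star_dotProduct_mulVec_eq_sum_mixed hU hV M ξ]
  set T : ℝ := ∑ i, ‖ξ i‖ with hT
  have hT0 : 0 ≤ T := Finset.sum_nonneg fun i _ => norm_nonneg _
  have hterm : ∀ j k, ‖star ((star U *ᵥ ξ) j) * (star U * M * V) j k * (star V *ᵥ ξ) k‖ ≤
      T * (κ * S) * T := by
    intro j k
    rw [norm_mul, norm_mul, norm_star]
    have h1 := norm_conjTranspose_mulVec_apply_le hU ξ j
    have h2 := norm_conjTranspose_mulVec_apply_le hV ξ k
    have h3 := hN j k
    have h4 : 0 ≤ κ * S := mul_nonneg hκ hS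
    gcongr
  have hsum : ‖∑ j, ∑ k, star ((star U *ᵥ ξ) j) * (star U * M * V) j k * (star V *ᵥ ξ) k‖ ≤
      ∑ j : m, ∑ k : m, T * (κ * S) * T :=
    (norm_sum_le _ _).trans (Finset.sum_le_sum fun j _ =>
      (norm_sum_le _ _).trans (Finset.sum_le_sum fun k _ => hterm j k))
  have hconst : ∑ j : m, ∑ k : m, T * (κ * S) * T = (Fintype.card m : ℝ) ^ 2 * κ * S * T ^ 2 := by
    simp only [Finset.sum_const, Finset.card_univ, nsmul_eq_mul]
    ring
  linarith [hsum, hconst]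

end QuadFormBound

section C1Approx

/-- Polynomials have polynomial antiderivatives. [folklore] -/
theorem exists_polynomial_derivative_eq (q : ℝ[X]) : ∃ Q : ℝ[X], Q.derivative = q := by
  refine ⟨∑ i ∈ q.support, Polynomial.C (q.coeff i / ((i : ℝ) + 1)) * Polynomial.X ^ (i + 1), ?_⟩
  rw [Polynomial.derivative_sum]
  conv_rhs => rw [q.as_sum_support_C_mul_X_pow]
  refine Finset.sum_congr rfl fun i _ => ?_
  rw [Polynomial.derivative_C_mul_X_pow]
  congr 2
  push_cast
  field_simp

/-- **Simultaneous polynomial approximation of a `C¹` function and its derivative on a compact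
interval** (Weierstrass applied to `f'`, then an antiderivative): for every `ε > 0` there is a
polynomial `p` with `|p - f| ≤ ε` and `|p' - f'| ≤ ε` on `[a, b]`. [folklore] -/
theorem exists_polynomial_near_with_derivative {f f' : ℝ → ℝ} {a b : ℝ} (hab : a ≤ b)
    (hf : ∀ x ∈ Icc a b, HasDerivAt f (f' x) x) (hf' : ContinuousOn f' (Icc a b)) {ε : ℝ}
    (hε : 0 < ε) :
    ∃ p : ℝ[X], (∀ x ∈ Icc a b, |p.eval x - f x| ≤ ε) ∧
      ∀ x ∈ Icc a b, |p.derivative.eval x - f' x| ≤ ε := by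
  set ε' : ℝ := ε / (b - a + 1) with hε'
  have hba : 0 < b - a + 1 := by linarith
  have hε'pos : 0 < ε' := by positivity
  have hε'le : ε' ≤ ε := by
    rw [hε', div_le_iff₀ hba]
    nlinarith
  obtain ⟨q, hq⟩ := exists_polynomial_near_of_continuousOn a b f' hf' ε' hε'pos
  obtain ⟨Q, hQ⟩ := exists_polynomial_derivative_eq q
  set p : ℝ[X] := Q + Polynomial.C (f a - Q.eval a) with hp
  have hpd : p.derivative = q := by rw [hp, Polynomial.derivative_add, Polynomial.derivative_C, add_zero, hQ]
  have hpa : p.eval a = f a := by rw [hp]; simp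
  refine ⟨p, fun x hx => ?_, fun x hx => ?_⟩
  · -- mean value theorem for `g = p - f`
    have hg : ∀ y ∈ Icc a b, HasDerivWithinAt (fun y => p.eval y - f y)
        (q.eval y - f' y) (Icc a b) y := by
      intro y hy
      have h1 := (Polynomial.hasDerivAt p y)
      rw [hpd] at h1
      exact (h1.sub (hf y hy)).hasDerivWithinAt
    have hbound : ∀ y ∈ Icc a b, ‖q.eval y - f' y‖ ≤ ε' := fun y hy =>
      (Real.norm_eq_abs _).le.trans (hq y hy).le
    have h := (convex_Icc a b).norm_image_sub_le_of_norm_hasDerivWithin_le hg hbound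
      (left_mem_Icc.2 hab) hx
    rw [hpa, sub_self, sub_zero, Real.norm_eq_abs, Real.norm_eq_abs] at h
    calc |p.eval x - f x| ≤ ε' * |x - a| := h
      _ ≤ ε' * (b - a + 1) := by
          gcongr
          rw [abs_of_nonneg (by linarith [hx.1])]
          linarith [hx.2]
      _ = ε := by rw [hε']; field_simp
  · rw [hpd]
    exact (hq x hx).le.trans hε'le

/-- **Lipschitz bound from the derivative** on an interval: `|g(u) - g(v)| ≤ κ |u - v|` when
`|g'| ≤ κ` on `[a, b] ∋ u, v`. [folklore] -/
theorem abs_sub_le_of_deriv_bound {g g' : ℝ → ℝ} {a b κ : ℝ}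
    (hg : ∀ x ∈ Icc a b, HasDerivAt g (g' x) x) (hκ : ∀ x ∈ Icc a b, |g' x| ≤ κ) {u v : ℝ}
    (hu : u ∈ Icc a b) (hv : v ∈ Icc a b) : |g u - g v| ≤ κ * |u - v| := by
  have h := (convex_Icc a b).norm_image_sub_le_of_norm_hasDerivWithin_le
    (fun x hx => (hg x hx).hasDerivWithinAt) (fun x hx => (Real.norm_eq_abs _).le.trans (hκ x hx))
    hv hu
  simpa [Real.norm_eq_abs] using h

end C1Approx

section TelescopingForm

variable {m : Type*} [Fintype m] [DecidableEq m]

/-- **First-order telescoping form of a polynomial** (the algebraic core of Hansen 2013,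
Lemma 3.1): for every real polynomial `p` there is a form `B(y, x)(h)`, continuous in `y` and
homogeneous in `h`, with `p(y) - p(x) = B(y, x)(y - x)` for all square matrices `x, y`, and whose
value at a real diagonal point `x = y = diag(d)` is the Schur product of `h` with the Loewner matrix
of `p` at `d` (confluent divided differences on coincident nodes).
[cite: Hansen2013, Lemma 3.1] -/
theorem exists_telescoping_form (p : ℝ[X]) :
    ∃ B : Matrix m m ℂ → Matrix m m ℂ → Matrix m m ℂ → Matrix m m ℂ,
      (∀ x y, aeval y p - aeval x p = B y x (y - x)) ∧
      (∀ x h, Continuous fun y => B y x h) ∧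
      (∀ y x h (t : ℂ), B y x (t • h) = t • B y x h) ∧
      (∀ U : Matrix m m ℂ, U ∈ Matrix.unitaryGroup m ℂ → ∀ D h : Matrix m m ℂ,
        B (U * D * star U) (U * D * star U) h = U * B D D (star U * h * U) * star U) ∧
      (∀ (d : m → ℝ) (h : Matrix m m ℂ) (i j : m),
        B (diagonal fun i => (d i : ℂ)) (diagonal fun i => (d i : ℂ)) h i j =
          h i j * ((if d i = d j then p.derivative.eval (d i)
            else slope (fun x => p.eval x) (d j) (d i) : ℝ) : ℂ)) := by
  have hconjpow : ∀ {U D : Matrix m m ℂ}, star U * U = 1 → ∀ a : ℕ,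
      (U * D * star U) ^ a = U * D ^ a * star U := by
    intro U D hU a
    induction a with
    | zero =>
      rw [pow_zero, pow_zero, Matrix.mul_one, mul_eq_one_comm.mp hU]
    | succ a ih =>
      rw [pow_succ, ih, pow_succ]
      rw [show U * D ^ a * star U * (U * D * star U) = U * D ^ a * (star U * U) * D * star U by
        simp only [Matrix.mul_assoc], hU, Matrix.mul_one]
      simp only [Matrix.mul_assoc]
  induction p using Polynomial.induction_on' with
  | add p q hp hq =>
    obtain ⟨B₁, h₁, c₁, s₁, u₁, d₁⟩ := hp
    obtain ⟨B₂, h₂, c₂, s₂, u₂, d₂⟩ := hq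
    refine ⟨fun y x h => B₁ y x h + B₂ y x h, fun x y => ?_, fun x h => (c₁ x h).add (c₂ x h),
      fun y x h t => ?_, fun U hU D h => ?_, fun d h i j => ?_⟩
    · dsimp only
      rw [map_add, map_add, ← h₁, ← h₂]; abel
    · dsimp only
      rw [s₁, s₂, smul_add]
    · dsimp only
      rw [u₁ U hU, u₂ U hU, Matrix.mul_add, Matrix.add_mul]
    · dsimp only
      rw [Matrix.add_apply, d₁, d₂, ← mul_add, ← ofReal_add]
      congr 2
      split_ifs with hij
      · rw [Polynomial.derivative_add, Polynomial.eval_add]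
      · simp only [slope_def_field, Polynomial.eval_add]
        field_simp
        ring
  | monomial k c =>
    refine ⟨fun y x h => (c : ℂ) • ∑ a ∈ Finset.range k, y ^ a * h * x ^ (k - 1 - a),
      fun x y => ?_, fun x h => ?_, fun y x h t => ?_, fun U hU D h => ?_, fun d h i j => ?_⟩
    · dsimp only
      have e1 : (algebraMap ℝ (Matrix m m ℂ)) c = (c : ℂ) • (1 : Matrix m m ℂ) := by
        rw [Algebra.algebraMap_eq_smul_one]; rfl
      rw [aeval_monomial, aeval_monomial, e1, smul_mul_assoc, one_mul, smul_mul_assoc, one_mul,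
        ← smul_sub, pow_sub_pow_eq_sum_mul_sub_mul]
    · have hc : Continuous fun y : Matrix m m ℂ => ∑ a ∈ Finset.range k, y ^ a * h * x ^ (k - 1 - a) :=
        continuous_finsetSum (Finset.range k) fun a _ =>
          ((continuous_pow a).mul continuous_const).mul continuous_const
      exact hc.const_smul (c : ℂ)
    · dsimp only
      rw [Finset.smul_sum, Finset.smul_sum, Finset.smul_sum]
      refine Finset.sum_congr rfl fun a _ => ?_
      rw [Matrix.mul_smul, Matrix.smul_mul, smul_comm]
    · dsimp only
      have hU' : star U * U = 1 := Matrix.mem_unitaryGroup_iff'.mp hU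
      rw [Matrix.mul_smul, Matrix.smul_mul, Finset.mul_sum, Finset.sum_mul]
      congr 1
      refine Finset.sum_congr rfl fun a _ => ?_
      rw [hconjpow hU', hconjpow hU']
      simp only [Matrix.mul_assoc]
    · dsimp only
      rw [Matrix.smul_apply, Matrix.sum_apply]
      have hterm : ∀ a ∈ Finset.range k,
          ((diagonal fun i => (d i : ℂ)) ^ a * h * (diagonal fun i => (d i : ℂ)) ^ (k - 1 - a)) i j =
            h i j * ((d i : ℂ) ^ a * (d j : ℂ) ^ (k - 1 - a)) := by
        intro a _
        rw [diagonal_pow, diagonal_pow, mul_diagonal, diagonal_mul]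
        simp only [Pi.pow_apply]
        ring
      rw [Finset.sum_congr rfl hterm, ← Finset.mul_sum, smul_eq_mul]
      have hsum : ∑ a ∈ Finset.range k, (d i : ℂ) ^ a * (d j : ℂ) ^ (k - 1 - a) =
          ((∑ a ∈ Finset.range k, d i ^ a * d j ^ (k - 1 - a) : ℝ) : ℂ) := by
        push_cast; rfl
      rw [hsum, sum_pow_mul_pow_eq_ite]
      rw [← mul_assoc, mul_comm (c : ℂ) (h i j), mul_assoc, ← ofReal_mul]
      congr 2
      split_ifs with hij
      · rw [← Polynomial.C_mul_X_pow_eq_monomial, Polynomial.derivative_C_mul,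
          Polynomial.eval_mul, Polynomial.eval_C]
      · simp only [slope_def_field, Polynomial.eval_monomial]
        have hne : d i - d j ≠ 0 := sub_ne_zero.2 hij
        field_simp

end TelescopingForm

section SpectrumLocalization

variable {m : Type*} [Fintype m] [DecidableEq m]

/-- Real and complex spectra of a complex matrix: `r ∈ σ_ℝ(M) ↔ (r : ℂ) ∈ σ_ℂ(M)`. [folklore] -/
theorem mem_spectrum_real_iff_complex {M : Matrix m m ℂ} {r : ℝ} :
    r ∈ spectrum ℝ M ↔ (r : ℂ) ∈ spectrum ℂ M := by
  rw [← spectrum.preimage_algebraMap (S := ℂ) (R := ℝ) (A := Matrix m m ℂ)]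
  rfl

/-- If `M - c` is positive semidefinite then the real spectrum of `M` lies in `[c, ∞)`. [folklore] -/
theorem spectrum_subset_Ici_of_posSemidef_sub {M : Matrix m m ℂ} {c : ℝ}
    (h : (M - (c : ℂ) • 1).PosSemidef) : spectrum ℝ M ⊆ Ici c := by
  intro r hr
  rw [mem_spectrum_real_iff_complex] at hr
  have h2 := (Matrix.posSemidef_iff_isHermitian_and_spectrum_nonneg.mp h).2
  have hmem : (r : ℂ) - (c : ℂ) ∈ spectrum ℂ (M - (c : ℂ) • (1 : Matrix m m ℂ)) := by
    have : (M - (c : ℂ) • (1 : Matrix m m ℂ)) = M - algebraMap ℂ (Matrix m m ℂ) (c : ℂ) := by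
      rw [Algebra.algebraMap_eq_smul_one]
    rw [this, ← spectrum.sub_singleton_eq]
    exact Set.sub_mem_sub hr (Set.mem_singleton _)
  have h3 := h2 hmem
  simp only [mem_setOf_eq] at h3
  rw [← ofReal_sub, Complex.zero_le_real, sub_nonneg] at h3
  exact h3

/-- If `c - M` is positive semidefinite then the real spectrum of `M` lies in `(-∞, c]`. [folklore] -/
theorem spectrum_subset_Iic_of_posSemidef_sub' {M : Matrix m m ℂ} {c : ℝ}
    (h : ((c : ℂ) • 1 - M).PosSemidef) : spectrum ℝ M ⊆ Iic c := by
  intro r hr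
  rw [mem_spectrum_real_iff_complex] at hr
  have h2 := (Matrix.posSemidef_iff_isHermitian_and_spectrum_nonneg.mp h).2
  have hmem : (c : ℂ) - (r : ℂ) ∈ spectrum ℂ ((c : ℂ) • (1 : Matrix m m ℂ) - M) := by
    have : ((c : ℂ) • (1 : Matrix m m ℂ) - M) = algebraMap ℂ (Matrix m m ℂ) (c : ℂ) - M := by
      rw [Algebra.algebraMap_eq_smul_one]
    rw [this, ← spectrum.singleton_sub_eq]
    exact Set.sub_mem_sub (Set.mem_singleton _) hr
  have h3 := h2 hmem
  simp only [mem_setOf_eq] at h3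
  rw [← ofReal_sub, Complex.zero_le_real, sub_nonneg] at h3
  exact h3

/-- The all-ones matrix `𝟙𝟙ᵀ` satisfies `0 ≤ 𝟙𝟙ᵀ ≤ (card m) • 1`. [folklore] -/
theorem posSemidef_of_ones :
    (Matrix.of fun _ _ : m => (1 : ℂ)).PosSemidef ∧
      (((Fintype.card m : ℝ) : ℂ) • (1 : Matrix m m ℂ) - Matrix.of fun _ _ : m => (1 : ℂ)).PosSemidef := by
  have hherm : (Matrix.of fun _ _ : m => (1 : ℂ)).IsHermitian := by
    unfold Matrix.IsHermitian; ext i j; simp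
  have hq : ∀ v : m → ℂ, star v ⬝ᵥ ((Matrix.of fun _ _ : m => (1 : ℂ)) *ᵥ v) =
      star (∑ i, v i) * ∑ i, v i := by
    intro v
    simp only [dotProduct, mulVec, Matrix.of_apply, one_mul, Pi.star_apply, star_sum,
      Finset.sum_mul]
  constructor
  · refine PosSemidef.of_dotProduct_mulVec_nonneg hherm fun v => ?_
    rw [hq]
    exact star_mul_self_nonneg _
  · have h1 : (((Fintype.card m : ℝ) : ℂ) • (1 : Matrix m m ℂ)).IsHermitian := by
      unfold Matrix.IsHermitian; rw [conjTranspose_smul, conjTranspose_one]; simp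
    refine PosSemidef.of_dotProduct_mulVec_nonneg (h1.sub hherm) fun v => ?_
    rw [sub_mulVec, dotProduct_sub, hq, Matrix.smul_mulVec, one_mulVec, dotProduct_smul]
    have e1 : star v ⬝ᵥ v = ((∑ i, Complex.normSq (v i) : ℝ) : ℂ) := by
      simp only [dotProduct, Pi.star_apply]
      push_cast
      refine Finset.sum_congr rfl fun i _ => ?_
      rw [Complex.normSq_eq_conj_mul_self]; rfl
    have e2 : star (∑ i, v i) * ∑ i, v i = ((Complex.normSq (∑ i, v i) : ℝ) : ℂ) := by
      rw [Complex.normSq_eq_conj_mul_self]; rfl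
    rw [e1, e2, smul_eq_mul, ← ofReal_mul, ← ofReal_sub, Complex.zero_le_real, sub_nonneg,
      Complex.normSq_eq_norm_sq]
    have h3 : ‖∑ i, v i‖ ^ 2 ≤ (∑ i, ‖v i‖) ^ 2 := by
      gcongr; exact norm_sum_le _ _
    have h4 : (∑ i, ‖v i‖) ^ 2 ≤ (Fintype.card m : ℝ) * ∑ i, ‖v i‖ ^ 2 := by
      have := sq_sum_le_card_mul_sum_sq (s := Finset.univ) (f := fun i => ‖v i‖)
      simpa using this
    simp_rw [Complex.normSq_eq_norm_sq]
    linarith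

end SpectrumLocalization

section LoewnerMatrixPSD

variable {m : Type*} [Fintype m] [DecidableEq m]

omit [DecidableEq m] in
/-- Hermitian quadratic forms are real. [folklore] -/
theorem im_star_dotProduct_mulVec_of_isHermitian {L : Matrix m m ℂ} (hL : L.IsHermitian)
    (ξ : m → ℂ) : (star ξ ⬝ᵥ (L *ᵥ ξ)).im = 0 := by
  have h : star (star ξ ⬝ᵥ (L *ᵥ ξ)) = star ξ ⬝ᵥ (L *ᵥ ξ) := by
    calc star (star ξ ⬝ᵥ (L *ᵥ ξ)) = star (L *ᵥ ξ) ⬝ᵥ ξ := by rw [star_dotProduct, star_star]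
      _ = (star ξ ᵥ* Lᴴ) ⬝ᵥ ξ := by rw [star_mulVec]
      _ = star ξ ⬝ᵥ (Lᴴ *ᵥ ξ) := (dotProduct_mulVec _ _ _).symm
      _ = star ξ ⬝ᵥ (L *ᵥ ξ) := by rw [hL.eq]
  rw [Complex.star_def] at h
  exact Complex.conj_eq_iff_im.mp h

omit [DecidableEq m] in
/-- A Hermitian matrix whose quadratic form has nonnegative real part is positive semidefinite.
[folklore] -/
theorem posSemidef_of_re_star_dotProduct_mulVec_nonneg {L : Matrix m m ℂ} (hL : L.IsHermitian)
    (h : ∀ ξ : m → ℂ, 0 ≤ (star ξ ⬝ᵥ (L *ᵥ ξ)).re) : L.PosSemidef := by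
  refine PosSemidef.of_dotProduct_mulVec_nonneg hL fun ξ => ?_
  rw [Complex.le_def]
  exact ⟨by simpa using h ξ, by simp [im_star_dotProduct_mulVec_of_isHermitian hL ξ]⟩

omit [DecidableEq m] in
/-- Quadratic forms depend continuously on the matrix (entrywise convergence). [folklore] -/
theorem tendsto_star_dotProduct_mulVec {ι : Type*} {l : Filter ι} {M : ι → Matrix m m ℂ}
    {M₀ : Matrix m m ℂ} (h : ∀ i j, Tendsto (fun k => M k i j) l (𝓝 (M₀ i j))) (ξ : m → ℂ) :
    Tendsto (fun k => star ξ ⬝ᵥ (M k *ᵥ ξ)) l (𝓝 (star ξ ⬝ᵥ (M₀ *ᵥ ξ))) := by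
  simp only [dotProduct, mulVec]
  refine tendsto_finsetSum _ fun i _ => Tendsto.const_mul _ (tendsto_finsetSum _ fun j _ => ?_)
  exact (h i j).mul_const _

omit [Fintype m] [DecidableEq m] in
/-- The Loewner matrix of a real function at real nodes (confluent values `f'` on coincident
nodes) is Hermitian. [folklore] -/
theorem isHermitian_loewnerMatrix (f f' : ℝ → ℝ) (d : m → ℝ) :
    (Matrix.of fun i j : m => ((if d i = d j then f' (d i) else slope f (d j) (d i) : ℝ) : ℂ)).IsHermitian := by
  unfold Matrix.IsHermitian
  ext i j
  rw [conjTranspose_apply, Matrix.of_apply, Matrix.of_apply, Complex.star_def, conj_ofReal]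
  congr 1
  by_cases hij : d i = d j
  · rw [if_pos hij, if_pos hij.symm, hij]
  · rw [if_neg hij, if_neg (Ne.symm hij), slope_comm]

end LoewnerMatrixPSD

section LoewnerCore

/-- **Core estimate for Löwner's characterization** (Hansen 2013, Theorem 3.2, `⇒`, quantitative
polynomial step). Let `f` be `n`-monotone for Hermitian matrices with spectra in `[a', b']`, let
the nodes `dᵢ` lie in `(a', b')`, and let `p` be a polynomial with `|p' - f'| ≤ δ` on `[a', b']`.
Then the Loewner matrix `L_p(d)` of `p` satisfies `Re ξ⋆ L_p(d) ξ ≥ -n⁴ δ (∑|ξᵢ|)²`.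
Proof: perturb `x = diag(d)` to `y = x + t𝟙𝟙ᵀ`; monotonicity gives `ξ⋆(f(y) - f(x))ξ ≥ 0`;
the polynomial part is `t ξ⋆B_p(y, x)(𝟙𝟙ᵀ)ξ` by the telescoping form, the remainder
`g = f - p` contributes `O(t δ)` by the mixed-basis identity and the Lipschitz bound `|g'| ≤ δ`;
divide by `t` and let `t → 0`. [cite: Hansen2013, Theorem 3.2] -/
theorem re_quadForm_loewner_polynomial_ge {N : ℕ} (d : Fin (N + 1) → ℝ) {a' b' : ℝ}
    (hd : ∀ i, d i ∈ Ioo a' b') {f f' : ℝ → ℝ} (hf : ∀ x ∈ Icc a' b', HasDerivAt f (f' x) x)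
    (hmono : ∀ A B : Matrix (Fin (N + 1)) (Fin (N + 1)) ℂ, A.IsHermitian → B.IsHermitian →
      spectrum ℝ A ⊆ Icc a' b' → spectrum ℝ B ⊆ Icc a' b' → (B - A).PosSemidef →
        (cfc f B - cfc f A).PosSemidef)
    (p : ℝ[X]) {δ : ℝ} (hδ : 0 ≤ δ) (hp' : ∀ x ∈ Icc a' b', |p.derivative.eval x - f' x| ≤ δ)
    (ξ : Fin (N + 1) → ℂ) :
    -(((N + 1 : ℕ) : ℝ) ^ 4 * δ * (∑ i, ‖ξ i‖) ^ 2) ≤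
      (star ξ ⬝ᵥ ((Matrix.of fun i j : Fin (N + 1) => ((if d i = d j then p.derivative.eval (d i)
        else slope (fun x => p.eval x) (d j) (d i) : ℝ) : ℂ)) *ᵥ ξ)).re := by
  -- the extreme nodes and the admissible perturbation size
  set M : ℝ := Finset.univ.sup' ⟨0, Finset.mem_univ _⟩ d with hM
  set L : ℝ := Finset.univ.inf' ⟨0, Finset.mem_univ _⟩ d with hL
  have hdM : ∀ i, d i ≤ M := fun i => Finset.le_sup' d (Finset.mem_univ i)
  have hdL : ∀ i, L ≤ d i := fun i => Finset.inf'_le d (Finset.mem_univ i)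
  have hMb : M < b' := by
    obtain ⟨i, -, hi⟩ := Finset.exists_mem_eq_sup' (⟨0, Finset.mem_univ _⟩ : (Finset.univ : Finset (Fin (N + 1))).Nonempty) d
    rw [hM, hi]; exact (hd i).2
  have hLa : a' < L := by
    obtain ⟨i, -, hi⟩ := Finset.exists_mem_eq_inf' (⟨0, Finset.mem_univ _⟩ : (Finset.univ : Finset (Fin (N + 1))).Nonempty) d
    rw [hL, hi]; exact (hd i).1
  set t₀ : ℝ := (b' - M) / (2 * (N + 1)) with ht₀
  have hnpos : (0 : ℝ) < N + 1 := by positivity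
  have ht₀pos : 0 < t₀ := by rw [ht₀]; exact div_pos (by linarith) (by positivity)
  -- the matrices
  set x : Matrix (Fin (N + 1)) (Fin (N + 1)) ℂ := diagonal fun i => (d i : ℂ) with hx
  set h : Matrix (Fin (N + 1)) (Fin (N + 1)) ℂ := Matrix.of fun _ _ => (1 : ℂ) with hh
  have hxh : x.IsHermitian := by
    rw [hx, Matrix.IsHermitian, diagonal_conjTranspose]; congr 1; funext i; simp
  have hhh : h.IsHermitian := by rw [hh]; unfold Matrix.IsHermitian; ext i j; simp
  obtain ⟨hhpsd, hhle⟩ := posSemidef_of_ones (m := Fin (N + 1))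
  have hcard : (Fintype.card (Fin (N + 1)) : ℝ) = N + 1 := by simp
  have hxsp : spectrum ℝ x ⊆ Icc a' b' := by
    intro r hr
    rw [mem_spectrum_real_iff_complex, hx, spectrum_diagonal] at hr
    obtain ⟨i, hi⟩ := hr
    simp only at hi
    have : r = d i := by exact_mod_cast hi.symm
    rw [this]; exact Ioo_subset_Icc_self (hd i)
  -- the telescoping form of `p`
  obtain ⟨B, hB1, hB2, hB3, -, hB4⟩ := exists_telescoping_form (m := Fin (N + 1)) p
  set T : ℝ := ∑ i, ‖ξ i‖ with hT
  set C : ℝ := ((N + 1 : ℕ) : ℝ) ^ 4 * (∑ i, ‖ξ i‖) ^ 2 with hC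
  -- the Lipschitz remainder
  set g : ℝ → ℝ := fun u => f u - p.eval u with hg
  have hgder : ∀ u ∈ Icc a' b', HasDerivAt g (f' u - p.derivative.eval u) u := fun u hu =>
    (hf u hu).sub (Polynomial.hasDerivAt p u)
  have hgbound : ∀ u ∈ Icc a' b', |f' u - p.derivative.eval u| ≤ δ := fun u hu => by
    rw [abs_sub_comm]; exact hp' u hu
  -- STEP 1: the inequality for each small `t > 0`
  have hstep : ∀ t : ℝ, 0 < t → t ≤ t₀ →
      0 ≤ (star ξ ⬝ᵥ (B (x + (t : ℂ) • h) x h *ᵥ ξ)).re + C * δ := by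
    intro t ht htt
    set y : Matrix (Fin (N + 1)) (Fin (N + 1)) ℂ := x + (t : ℂ) • h with hy
    have hyh : y.IsHermitian := by
      rw [hy]; refine hxh.add ?_
      unfold Matrix.IsHermitian; rw [conjTranspose_smul, hhh.eq]; simp
    have hyx : y - x = (t : ℂ) • h := by rw [hy]; abel
    have hth : ((t : ℂ) • h).PosSemidef := by
      have : ((t : ℂ) • h) = t • h := rfl
      rw [this]; exact hhpsd.smul ht.le
    -- spectrum of `y`
    have hysp : spectrum ℝ y ⊆ Icc a' b' := by
      have h1 : spectrum ℝ y ⊆ Ici L := by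
        apply spectrum_subset_Ici_of_posSemidef_sub
        have : y - (L : ℂ) • 1 = (x - (L : ℂ) • 1) + (t : ℂ) • h := by rw [hy]; abel
        rw [this]
        refine PosSemidef.add ?_ hth
        rw [hx, smul_one_eq_diagonal, diagonal_sub]
        refine PosSemidef.diagonal fun i => ?_
        rw [← ofReal_sub]
        exact Complex.zero_le_real.mpr (by linarith [hdL i])
      have h2 : spectrum ℝ y ⊆ Iic (M + t * (N + 1)) := by
        apply spectrum_subset_Iic_of_posSemidef_sub'
        have : ((M + t * (N + 1) : ℝ) : ℂ) • (1 : Matrix (Fin (N + 1)) (Fin (N + 1)) ℂ) - y =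
            ((M : ℂ) • 1 - x) + (t : ℂ) • ((((N + 1 : ℕ) : ℝ) : ℂ) • 1 - h) := by
          rw [hy]; push_cast
          module
        rw [this]
        refine PosSemidef.add ?_ ?_
        · rw [hx, smul_one_eq_diagonal, diagonal_sub]
          refine PosSemidef.diagonal fun i => ?_
          rw [← ofReal_sub]
          exact Complex.zero_le_real.mpr (by linarith [hdM i])
        · have e : ((t : ℂ) • ((((N + 1 : ℕ) : ℝ) : ℂ) • (1 : Matrix (Fin (N + 1)) (Fin (N + 1)) ℂ) - h))
              = t • ((((N + 1 : ℕ) : ℝ) : ℂ) • (1 : Matrix (Fin (N + 1)) (Fin (N + 1)) ℂ) - h) := rfl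
          rw [e]
          have hhle' := hhle
          rw [hcard] at hhle'
          push_cast at hhle' ⊢
          exact hhle'.smul ht.le
      intro r hr
      refine ⟨(hLa.le.trans (h1 hr)), (h2 hr).trans ?_⟩
      have : t * (N + 1) ≤ (b' - M) / 2 := by
        calc t * (N + 1) ≤ t₀ * (N + 1) := by gcongr
          _ = (b' - M) / 2 := by rw [ht₀]; field_simp
      linarith
    -- monotonicity
    have hPSD := hmono x y hxh hyh hxsp hysp (by rw [hyx]; exact hth)
    have hq0 : 0 ≤ (star ξ ⬝ᵥ ((cfc f y - cfc f x) *ᵥ ξ)).re :=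
      (Complex.le_def.mp (hPSD.dotProduct_mulVec_nonneg ξ)).1
    -- decomposition `f = p + g`
    have hdecomp : ∀ {E : Matrix (Fin (N + 1)) (Fin (N + 1)) ℂ}, E.IsHermitian →
        cfc f E = aeval E p + cfc g E := by
      intro E hE
      have hE' : IsSelfAdjoint E := hE
      have hfin := Matrix.finite_real_spectrum (A := E)
      have h1 : f = fun u => p.eval u + g u := by funext u; simp [hg]
      conv_lhs => rw [h1]
      rw [cfc_add (a := E) (fun u => p.eval u) g (hfin.continuousOn _) (hfin.continuousOn _),
        cfc_polynomial p E hE']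
    have hqsplit : star ξ ⬝ᵥ ((cfc f y - cfc f x) *ᵥ ξ) =
        (t : ℂ) * (star ξ ⬝ᵥ (B y x h *ᵥ ξ)) + star ξ ⬝ᵥ ((cfc g y - cfc g x) *ᵥ ξ) := by
      rw [hdecomp hyh, hdecomp hxh]
      have : aeval y p + cfc g y - (aeval x p + cfc g x) =
          (aeval y p - aeval x p) + (cfc g y - cfc g x) := by abel
      rw [this, hB1 x y, hyx, hB3, add_mulVec, dotProduct_add, Matrix.smul_mulVec, dotProduct_smul,
        smul_eq_mul]
    -- the remainder bound
    set V : Matrix (Fin (N + 1)) (Fin (N + 1)) ℂ :=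
      ((hyh.eigenvectorUnitary : Matrix.unitaryGroup (Fin (N + 1)) ℂ) : Matrix (Fin (N + 1)) (Fin (N + 1)) ℂ) with hV
    have hVu : V ∈ Matrix.unitaryGroup (Fin (N + 1)) ℂ := hyh.eigenvectorUnitary.2
    have h1u : (1 : Matrix (Fin (N + 1)) (Fin (N + 1)) ℂ) ∈ Matrix.unitaryGroup (Fin (N + 1)) ℂ :=
      one_mem _
    set μ : Fin (N + 1) → ℝ := hyh.eigenvalues with hμ
    have hydec : y = V * diagonal (fun i => (μ i : ℂ)) * star V := by
      have := hyh.spectral_theorem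
      rw [Unitary.conjStarAlgAut_apply] at this
      exact this
    have hxdec : x = 1 * diagonal (fun i => (d i : ℂ)) * star 1 := by rw [hx]; simp
    have hμJ : ∀ k, μ k ∈ Icc a' b' := fun k => hysp (hyh.eigenvalues_mem_spectrum_real k)
    have hdJ : ∀ j, d j ∈ Icc a' b' := fun j => Ioo_subset_Icc_self (hd j)
    have hentry : ∀ j k, ‖(star (1 : Matrix (Fin (N + 1)) (Fin (N + 1)) ℂ) * (cfc g y - cfc g x) * V) j k‖ ≤
        δ * (t * (N + 1) ^ 2) := by
      intro j k
      rw [hydec, hxdec, conjTranspose_mul_cfc_sub_cfc_mul_apply h1u hVu d μ g j k, norm_mul,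
        Complex.norm_real, Real.norm_eq_abs]
      have hlip : |g (μ k) - g (d j)| ≤ δ * |μ k - d j| :=
        abs_sub_le_of_deriv_bound hgder hgbound (hμJ k) (hdJ j)
      have hW : ‖((μ k - d j : ℝ) : ℂ) * (star (1 : Matrix (Fin (N + 1)) (Fin (N + 1)) ℂ) * V) j k‖ ≤
          t * (N + 1) ^ 2 := by
        rw [← conjTranspose_mul_sub_mul_apply h1u hVu d μ j k, ← hydec, ← hxdec, hyx]
        refine (norm_conjTranspose_mul_mul_apply_le h1u hVu _ j k).trans ?_
        simp only [Matrix.smul_apply, hh, Matrix.of_apply, smul_eq_mul, mul_one, norm_real,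
          Real.norm_eq_abs, abs_of_pos ht, Finset.sum_const, Finset.card_univ, Fintype.card_fin,
          nsmul_eq_mul]
        push_cast
        nlinarith
      rw [norm_mul, Complex.norm_real, Real.norm_eq_abs] at hW
      calc |g (μ k) - g (d j)| * ‖(star (1 : Matrix (Fin (N + 1)) (Fin (N + 1)) ℂ) * V) j k‖
          ≤ δ * |μ k - d j| * ‖(star (1 : Matrix (Fin (N + 1)) (Fin (N + 1)) ℂ) * V) j k‖ := by
            gcongr
        _ = δ * (|μ k - d j| * ‖(star (1 : Matrix (Fin (N + 1)) (Fin (N + 1)) ℂ) * V) j k‖) := by ring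
        _ ≤ δ * (t * (N + 1) ^ 2) := by gcongr
    have hrem : ‖star ξ ⬝ᵥ ((cfc g y - cfc g x) *ᵥ ξ)‖ ≤ t * (C * δ) := by
      have h := norm_star_dotProduct_mulVec_le h1u hVu hδ (by positivity) hentry ξ
      rw [Fintype.card_fin] at h
      rw [hC]
      push_cast at h ⊢
      nlinarith [h]
    -- combine and divide by `t`
    have hre : (star ξ ⬝ᵥ ((cfc f y - cfc f x) *ᵥ ξ)).re =
        t * (star ξ ⬝ᵥ (B y x h *ᵥ ξ)).re + (star ξ ⬝ᵥ ((cfc g y - cfc g x) *ᵥ ξ)).re := by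
      rw [hqsplit, add_re, re_ofReal_mul]
    have hre2 : (star ξ ⬝ᵥ ((cfc g y - cfc g x) *ᵥ ξ)).re ≤ t * (C * δ) :=
      (Complex.re_le_norm _).trans hrem
    have : 0 ≤ t * ((star ξ ⬝ᵥ (B y x h *ᵥ ξ)).re + C * δ) := by nlinarith [hq0, hre, hre2]
    exact (mul_nonneg_iff_of_pos_left ht).mp this
  -- STEP 2: let `t → 0⁺`
  set tk : ℕ → ℝ := fun k => t₀ / ((k : ℝ) + 2) with htk
  have htk_pos : ∀ k, 0 < tk k := fun k => by rw [htk]; positivity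
  have htk_le : ∀ k, tk k ≤ t₀ := fun k => by
    rw [htk]
    exact div_le_self ht₀pos.le (by have hk : (0 : ℝ) ≤ k := Nat.cast_nonneg k; linarith)
  have htk_lim : Tendsto tk atTop (𝓝 0) := by
    rw [htk]
    exact tendsto_const_nhds.div_atTop
      (tendsto_atTop_add_const_right _ 2 tendsto_natCast_atTop_atTop)
  have hy_lim : Tendsto (fun k => x + (tk k : ℂ) • h) atTop (𝓝 x) := by
    have h1 : Tendsto (fun k => (tk k : ℂ) • h) atTop (𝓝 (((0 : ℝ) : ℂ) • h)) :=
      ((continuous_ofReal.tendsto 0).comp htk_lim).smul_const h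
    simpa using tendsto_const_nhds.add h1
  have hB_lim : Tendsto (fun k => B (x + (tk k : ℂ) • h) x h) atTop (𝓝 (B x x h)) :=
    ((hB2 x h).tendsto x).comp hy_lim
  have hq_lim : Tendsto (fun k => (star ξ ⬝ᵥ (B (x + (tk k : ℂ) • h) x h *ᵥ ξ)).re + C * δ) atTop
      (𝓝 ((star ξ ⬝ᵥ (B x x h *ᵥ ξ)).re + C * δ)) := by
    refine Tendsto.add_const _ ((continuous_re.tendsto _).comp
      (tendsto_star_dotProduct_mulVec (fun i j => ?_) ξ))
    exact ((continuous_apply j).comp (continuous_apply i)).continuousAt.tendsto.comp hB_lim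
  have hlim_ge : 0 ≤ (star ξ ⬝ᵥ (B x x h *ᵥ ξ)).re + C * δ :=
    ge_of_tendsto' hq_lim fun k => hstep (tk k) (htk_pos k) (htk_le k)
  -- STEP 3: `B(x, x)(𝟙𝟙ᵀ)` is the Loewner matrix of `p`
  have hBxx : B x x h = Matrix.of fun i j : Fin (N + 1) =>
      ((if d i = d j then p.derivative.eval (d i)
        else slope (fun x => p.eval x) (d j) (d i) : ℝ) : ℂ) := by
    ext i j
    rw [hx, hB4 d h i j, Matrix.of_apply, hh, Matrix.of_apply, one_mul]
  rw [hBxx, hC] at hlim_ge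
  linarith

end LoewnerCore

section LoewnerMain

/-- Convergence of pointwise-and-derivative approximants at a node pair gives convergence of the
confluent divided differences. [folklore] -/
theorem tendsto_loewner_entry {f f' : ℝ → ℝ} {p : ℕ → ℝ[X]} {u v : ℝ}
    (hu : Tendsto (fun k => (p k).eval u) atTop (𝓝 (f u)))
    (hv : Tendsto (fun k => (p k).eval v) atTop (𝓝 (f v)))
    (hu' : Tendsto (fun k => (p k).derivative.eval u) atTop (𝓝 (f' u))) :
    Tendsto (fun k => (if u = v then (p k).derivative.eval u
      else slope (fun x => (p k).eval x) v u : ℝ)) atTop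
      (𝓝 (if u = v then f' u else slope f v u)) := by
  split_ifs with h
  · exact hu'
  · simp only [slope_def_field]
    exact (hu.sub hv).div_const _

/-- **Löwner's characterization, necessity** (Löwner 1934; Hansen 2013, Theorem 3.2, `⇒`): if a
`C¹` function `f` on an open interval `(a, b)` is `n`-monotone there, then every Loewner matrix
`([dᵢ, dⱼ]_f)ᵢⱼ` (`[d, d]_f = f'(d)`) at nodes `d₁, …, dₙ ∈ (a, b)` is positive semidefinite.
The proof follows Hansen's first-order perturbation `x ↦ x + t𝟙𝟙ᵀ` with the matrix calculus made
algebraic: polynomials `pₖ → f` in `C¹` (Weierstrass), exact telescoping for `pₖ`, and the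
mixed-basis Lipschitz estimate for `f - pₖ`. [cite: Hansen2013, Theorem 3.2] -/
theorem loewner_matrix_posSemidef_of_monotone {f f' : ℝ → ℝ} {a b : ℝ}
    (hf : ∀ x ∈ Ioo a b, HasDerivAt f (f' x) x) (hf' : ContinuousOn f' (Ioo a b)) {n : ℕ}
    (hmono : ∀ A B : Matrix (Fin n) (Fin n) ℂ, A.IsHermitian → B.IsHermitian →
      spectrum ℝ A ⊆ Ioo a b → spectrum ℝ B ⊆ Ioo a b → (B - A).PosSemidef →
        (cfc f B - cfc f A).PosSemidef)
    (d : Fin n → ℝ) (hd : ∀ i, d i ∈ Ioo a b) :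
    (Matrix.of fun i j : Fin n => ((if d i = d j then f' (d i)
      else slope f (d j) (d i) : ℝ) : ℂ)).PosSemidef := by
  cases n with
  | zero =>
    refine PosSemidef.of_dotProduct_mulVec_nonneg (isHermitian_loewnerMatrix f f' d) fun ξ => ?_
    simp [dotProduct]
  | succ N =>
    -- a compact subinterval `[a', b'] ⊆ (a, b)` around the nodes
    set M : ℝ := Finset.univ.sup' ⟨0, Finset.mem_univ _⟩ d with hM
    set L : ℝ := Finset.univ.inf' ⟨0, Finset.mem_univ _⟩ d with hL
    have hdM : ∀ i, d i ≤ M := fun i => Finset.le_sup' d (Finset.mem_univ i)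
    have hdL : ∀ i, L ≤ d i := fun i => Finset.inf'_le d (Finset.mem_univ i)
    have hMb : M < b := by
      obtain ⟨i, -, hi⟩ := Finset.exists_mem_eq_sup'
        (⟨0, Finset.mem_univ _⟩ : (Finset.univ : Finset (Fin (N + 1))).Nonempty) d
      rw [hM, hi]; exact (hd i).2
    have hLa : a < L := by
      obtain ⟨i, -, hi⟩ := Finset.exists_mem_eq_inf'
        (⟨0, Finset.mem_univ _⟩ : (Finset.univ : Finset (Fin (N + 1))).Nonempty) d
      rw [hL, hi]; exact (hd i).1
    set a' : ℝ := (a + L) / 2 with ha'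
    set b' : ℝ := (M + b) / 2 with hb'
    have hsub : Icc a' b' ⊆ Ioo a b := fun x hx => ⟨by linarith [hx.1], by linarith [hx.2]⟩
    have hd' : ∀ i, d i ∈ Ioo a' b' := fun i =>
      ⟨by linarith [hdL i], by linarith [hdM i]⟩
    have hfJ : ∀ x ∈ Icc a' b', HasDerivAt f (f' x) x := fun x hx => hf x (hsub hx)
    have hf'J : ContinuousOn f' (Icc a' b') := hf'.mono hsub
    have hmonoJ : ∀ A B : Matrix (Fin (N + 1)) (Fin (N + 1)) ℂ, A.IsHermitian → B.IsHermitian →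
        spectrum ℝ A ⊆ Icc a' b' → spectrum ℝ B ⊆ Icc a' b' → (B - A).PosSemidef →
          (cfc f B - cfc f A).PosSemidef := fun A B hA hB hAs hBs =>
      hmono A B hA hB (hAs.trans hsub) (hBs.trans hsub)
    have hab' : a' ≤ b' := by
      have := hd' 0; linarith [this.1, this.2]
    -- polynomial approximants
    have happrox : ∀ k : ℕ, ∃ p : ℝ[X], (∀ x ∈ Icc a' b', |p.eval x - f x| ≤ 1 / ((k : ℝ) + 1)) ∧
        ∀ x ∈ Icc a' b', |p.derivative.eval x - f' x| ≤ 1 / ((k : ℝ) + 1) := fun k =>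
      exists_polynomial_near_with_derivative hab' hfJ hf'J (by positivity)
    choose p hp hp' using happrox
    -- pass to the limit in the core estimate
    refine posSemidef_of_re_star_dotProduct_mulVec_nonneg (isHermitian_loewnerMatrix f f' d)
      fun ξ => ?_
    have hδ_lim : Tendsto (fun k : ℕ => 1 / ((k : ℝ) + 1)) atTop (𝓝 0) :=
      tendsto_one_div_add_atTop_nhds_zero_nat
    have hnode : ∀ u ∈ Icc a' b', Tendsto (fun k => (p k).eval u) atTop (𝓝 (f u)) := by
      intro u hu
      refine tendsto_iff_norm_sub_tendsto_zero.mpr ?_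
      refine squeeze_zero (fun k => norm_nonneg _) (fun k => ?_) hδ_lim
      rw [Real.norm_eq_abs]; exact hp k u hu
    have hnode' : ∀ u ∈ Icc a' b', Tendsto (fun k => (p k).derivative.eval u) atTop (𝓝 (f' u)) := by
      intro u hu
      refine tendsto_iff_norm_sub_tendsto_zero.mpr ?_
      refine squeeze_zero (fun k => norm_nonneg _) (fun k => ?_) hδ_lim
      rw [Real.norm_eq_abs]; exact hp' k u hu
    have hdJ : ∀ i, d i ∈ Icc a' b' := fun i => Ioo_subset_Icc_self (hd' i)
    have hL_lim : Tendsto (fun k => (star ξ ⬝ᵥ ((Matrix.of fun i j : Fin (N + 1) =>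
        ((if d i = d j then (p k).derivative.eval (d i)
          else slope (fun x => (p k).eval x) (d j) (d i) : ℝ) : ℂ)) *ᵥ ξ)).re) atTop
        (𝓝 ((star ξ ⬝ᵥ ((Matrix.of fun i j : Fin (N + 1) => ((if d i = d j then f' (d i)
          else slope f (d j) (d i) : ℝ) : ℂ)) *ᵥ ξ)).re)) := by
      refine (continuous_re.tendsto _).comp (tendsto_star_dotProduct_mulVec (fun i j => ?_) ξ)
      simp only [Matrix.of_apply]
      exact (continuous_ofReal.tendsto _).comp
        (tendsto_loewner_entry (hnode _ (hdJ i)) (hnode _ (hdJ j)) (hnode' _ (hdJ i)))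
    have hlow_lim : Tendsto (fun k : ℕ => -((((N + 1 : ℕ) : ℝ)) ^ 4 * (1 / ((k : ℝ) + 1)) *
        (∑ i, ‖ξ i‖) ^ 2)) atTop (𝓝 0) := by
      have : Tendsto (fun k : ℕ => -((((N + 1 : ℕ) : ℝ)) ^ 4 * (1 / ((k : ℝ) + 1)) *
          (∑ i, ‖ξ i‖) ^ 2)) atTop (𝓝 (-((((N + 1 : ℕ) : ℝ)) ^ 4 * 0 * (∑ i, ‖ξ i‖) ^ 2))) :=
        ((hδ_lim.const_mul _).mul_const _).neg
      simpa using this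
    exact le_of_tendsto_of_tendsto' hlow_lim hL_lim fun k =>
      re_quadForm_loewner_polynomial_ge d hd' hfJ hmonoJ (p k) (by positivity) (hp' k) ξ

end LoewnerMain

end Literature.Analysis.Complex
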